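import Mathlib
import Summits.QuantumFields.BalabanUV.Beta.EriceRemainderEnclosureHistoryAutonomyComparisonAgeCompositionStaticChainCertificate
import Summits.QuantumFields.BalabanUV.Beta.EriceRemainderEnclosureHistoryAutonomyComparisonAgeCompositionStaticChainWindowMass

/-!
# EriceRemainderEnclosureHistoryAutonomyComparisonAgeCompositionStaticChainResolvent — (E78b) THE RESOLVENT SIDE OF THE OBSERVER INDUCTION: Schur pivot
# and bordered responses (the exact cap `x̂_y` is the zero of the pivot), the RANK-ONE UPDATE of the return amplification `Ψ_zz` when an age is added,
# the COVARIANCE BOUND that makes close observers act as if the resolvent were rank one, and THE STRUCTURAL LEMMA «window mass ≤ return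
# amplification» `Ψ_yy ≥ λ₁Ω_y∕(1 − λ₂Ω_y)` with explicit read-window constants — the inputs that reduce the step inequality (◆) to one dimension

Cell `pub-balaban`, β-function sub-cell, BINDER row D4 «RemainderConst leaves for Bałaban's split» (`HOME/BINDER-OWNERS.md`; owner lineage `b2b-balaban-beta-an4`;
this file by co-owner #2 lineage `b2b-balaban-beta-d4-p2`, generation 69), β-FLOW TEAM duty (1), FREEZE (0) honoured (def-free; imports (E78a) `…StaticChainCertificate`
and (E74a) `…StaticChainWindowMass` (`readWindow_mono_left`); nothing restated).

HONEST FRAMING (page 1, verbatim and binding).  *"Discharging BetaPertH makes Bałaban's UV stability UNCONDITIONAL — a real constructive-QFT result; it is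
NOT the continuum limit and NOT the Clay problem."*  THIS FILE DISCHARGES NOTHING OF THE KIND.  Elementary linear algebra of finite non-negative arrays, finite
sums and square roots — hypotheses of a census, not facts; the age profile of Bałaban's (1.22) limit functional is NOT PRINTED ([I] p. 298; GAPS G-t4-U2-1∕-2)
and NOT asserted.  Row D4 class UNCHANGED (critical-path width 0; instance 0∕1; D4 DISCHARGE NO DATE).  HONEST DEPENDENCY: continuum YM on T⁴ ⇐ BetaPertH ∧ nine
spine estimates (0/9 proved); BetaPertH ⇐ (D1) ∧ (D4) ∧ CAP+tail; G-an2-4 gates asym, D1 and NE2/3/4.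

THE POINT (census sense (α); route (N′); README `HOME/b2b-balaban-beta-d4-p2/g69/e78/README.md` §4–§5).  (E78a) reduced static closure over the level-coupled
system to the OBSERVER INDUCTION `N_z ≤ (1 + 2κΨ_zz)(1 − Ω_z)` whose step is ONE resolvent inequality (◆).  This file supplies what (◆) is made of.  §1:
when an age `y` is added below a processed system, every exact response of the bordered system is the old response plus a multiple of the old response
`c` to the new reads, the multiple being fixed by the SCHUR PIVOT `D_y = 1 − 2x_y(s_y + Ψ_yy)` (`bordered_response`, `bordered_levels`: `a'_y = A_y∕D_y`); the
pivot is positive on the feasible set (`pivot_pos`: otherwise `(2x_y c, 1)` is a subsolution) — i.e. `x_y < x̂_y = 1∕(2(s_y+Ψ_yy))`, the EXACT CAP.  §2: every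
row functional updates by a rank-one term (`functional_bordered`); for the observer `z`: `Ψ'_zz = Ψ_zz + (2x_y∕D_y)(σ_y(z)+Ψ_yz)(φ_y(z)+Ψ_zy)`.  §3: the cross
Gram determinant `Ψ_yyΨ_zz − Ψ_yzΨ_zy` is at most `ΔαΔβ·Ψ_yy²` where `Δα, Δβ` are the spreads of the observer ratios `σ_·(z)∕σ_·(y)`, `φ^z∕φ^y` over the
processed ages (`covariance_bound`; measured `det∕ΨΨ ≤ 5e-6` at every maximiser).  §4–§5: levels from row sums and THE STRUCTURAL LEMMA
(`return_amplification_ge`, `return_amplification_ge_lattice`): **`Ψ_yy ≥ λ₁Ω_y∕(1 − λ₂Ω_y)`**, `λ₁ = 2S_{y,y+1}S_{y+1,y}∕y²`, `λ₂ = 2S_{y+1,y+1}∕y` — the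
curve on which the step ratio of (◆) is extremal (README §5: the 1-D certificate along it reproduces the adversarial supremum `0.914–0.915` of kit j318356∕7∕8;
`jobC`: never violated, attained at one light elder at age `y+1`).  NOT CLAIMED: (◆); the static closure; anything about the flow; MONO; nonlinear; printed.

WHAT IS PROVED ([folklore]; 0 `def`, 0 sorry).  §1 **`bordered_response`**, `bordered_levels`, **`pivot_pos`**.  §2 **`functional_bordered`**.  §3 `wsum_shift`,
**`covariance_bound`**.  §4 `subresponse_le_response`, `level_ge_of_rowsum`, **`return_amplification_ge`**, `return_amplification_ge_window`.  §5
`readWindow_mono_right`, **`return_amplification_ge_lattice`**.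
-/
noncomputable section
open Finset

namespace Summit.QuantumFields.BalabanUV.Beta.EriceRemainderEnclosureHistoryAutonomyComparisonAgeCompositionStaticChainResolvent

open Summit.QuantumFields.BalabanUV.Beta.EriceRemainderEnclosureHistoryAutonomyComparisonAgeCompositionStaticChainCertificate

variable {n : ℕ} {G : ℕ → ℕ → ℝ} {a c u w φ e f q : ℕ → ℝ} {g xy2 wy fy D : ℝ}

/-! ## §1 The bordered system: Schur pivot, bordered responses, positivity of the pivot -/

/-- **BORDERED RESPONSES (Schur complement).**  Old system: array `G` on `range n` (`G i l = 2x_l S(k_l,k_i)∕k_l`); a new age `y` below it enters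
every old row `i` with the coefficient `xy2·φ_i` (`xy2 = 2x_y`, `φ_i = S(y,k_i)∕y` the new age's reads), and has its own row `Σ_l e_l(·)_l + g(·)_y`
(`e_l = 2x_lσ_l(y)`, `σ_l(y) = S(k_l,y)∕k_l`, `g = 2x_y s_y`).  If `c` is the old response to `φ` (`c_i = φ_i + Σ_l G_{il}c_l`), `u` the old response
to a source `w`, `Ψ := Σ_l e_l c_l` the RETURN AMPLIFICATION and `D := 1 − g − xy2·Ψ` the SCHUR PIVOT (`D ≠ 0`), then
`u'_y := (w_y + Σ_l e_l u_l)∕D`, `u'_i := u_i + xy2·u'_y·c_i` is an exact response of the BORDERED system to the source `(w, w_y)`: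
old rows `u'_i = w_i + Σ_l G_{il}u'_l + xy2·φ_i·u'_y`, new row `u'_y = w_y + Σ_l e_l u'_l + g·u'_y`. [folklore] -/
theorem bordered_response {u' : ℕ → ℝ} {uy' : ℝ}
    (hc : ∀ i, i < n → c i = φ i + ∑ l ∈ range n, G i l * c l)
    (hu : ∀ i, i < n → u i = w i + ∑ l ∈ range n, G i l * u l)
    (hD : D = 1 - g - xy2 * ∑ l ∈ range n, e l * c l) (hD0 : D ≠ 0)
    (huy' : uy' = (wy + ∑ l ∈ range n, e l * u l) / D)
    (hu' : ∀ i, i < n → u' i = u i + xy2 * uy' * c i) :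
    (∀ i, i < n → u' i = w i + ∑ l ∈ range n, G i l * u' l + xy2 * φ i * uy') ∧
      uy' = wy + ∑ l ∈ range n, e l * u' l + g * uy' := by
  constructor
  · intro i hi
    have hsplit : ∑ l ∈ range n, G i l * u' l = ∑ l ∈ range n, G i l * u l + xy2 * uy' * ∑ l ∈ range n, G i l * c l := by
      rw [mul_sum, ← sum_add_distrib]
      exact sum_congr rfl fun l hl => by rw [hu' l (mem_range.mp hl)]; ring
    rw [hsplit, hu' i hi, hu i hi, hc i hi]; ring
  · have hsplit : ∑ l ∈ range n, e l * u' l = ∑ l ∈ range n, e l * u l + xy2 * uy' * ∑ l ∈ range n, e l * c l := by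
      rw [mul_sum, ← sum_add_distrib]
      exact sum_congr rfl fun l hl => by rw [hu' l (mem_range.mp hl)]; ring
    rw [hsplit]
    have hkey : uy' * D = wy + ∑ l ∈ range n, e l * u l := by rw [huy', div_mul_cancel₀ _ hD0]
    rw [hD] at hkey
    linarith [hkey]

/-- **BORDERED LEVELS.**  With `w = 1`, `w_y = 1`: the new age's level is `a'_y = A∕D` with `A := 1 + Σ_l e_l a_l` the UNLOADED LEVEL at the new scale, and
the old levels rise by `xy2·a'_y·c_i` (the new age's reads, amplified by the old system). [folklore] -/
theorem bordered_levels {a' : ℕ → ℝ} {ay' : ℝ}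
    (hc : ∀ i, i < n → c i = φ i + ∑ l ∈ range n, G i l * c l)
    (ha : ∀ i, i < n → a i = 1 + ∑ l ∈ range n, G i l * a l)
    (hD : D = 1 - g - xy2 * ∑ l ∈ range n, e l * c l) (hD0 : D ≠ 0)
    (hay' : ay' = (1 + ∑ l ∈ range n, e l * a l) / D)
    (ha' : ∀ i, i < n → a' i = a i + xy2 * ay' * c i) :
    (∀ i, i < n → a' i = 1 + ∑ l ∈ range n, G i l * a' l + xy2 * φ i * ay') ∧
      ay' = 1 + ∑ l ∈ range n, e l * a' l + g * ay' :=
  bordered_response (w := fun _ => 1) (wy := 1) hc ha hD hD0 hay' ha'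

/-- **THE PIVOT IS POSITIVE ON THE FEASIBLE SET.**  If the bordered system (old ages + the new age with load `x_y`, `xy2 = 2x_y ≥ 0`) has positive levels
(row inequalities), `G, φ, e, g ≥ 0` and the old response `c` to `φ` is non-negative, then `D = 1 − g − xy2·Ψ > 0`: otherwise `(xy2·c, 1)` is a non-negative
subsolution with a positive entry ((E78a) `eq_zero_of_subsolution`).  Equivalently `x_y < x̂_y := 1∕(2(s_y + Ψ_yy))`: THE EXACT CAP of the young load is the
zero of the Schur pivot ((E78a) `load_mul_lt_one_of_certificate` with `M = 2(s+Ψ)`). [folklore] -/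
theorem pivot_pos {a' : ℕ → ℝ} {ay' : ℝ}
    (hG : ∀ i l, i < n → l < n → 0 ≤ G i l) (hφ : ∀ i, i < n → 0 ≤ φ i) (he : ∀ l, l < n → 0 ≤ e l) (hg : 0 ≤ g) (hxy : 0 ≤ xy2)
    (ha' : ∀ i, i < n → 0 < a' i) (hay' : 0 < ay')
    (hrow : ∀ i, i < n → 1 + ∑ l ∈ range n, G i l * a' l + xy2 * φ i * ay' ≤ a' i)
    (hrowy : 1 + ∑ l ∈ range n, e l * a' l + g * ay' ≤ ay')
    (hc : ∀ i, i < n → c i = φ i + ∑ l ∈ range n, G i l * c l) (hc0 : ∀ i, i < n → 0 ≤ c i)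
    (hD : D = 1 - g - xy2 * ∑ l ∈ range n, e l * c l) : 0 < D := by
  by_contra hcon
  have hcon : D ≤ 0 := not_lt.mp hcon
  let G' : ℕ → ℕ → ℝ := fun i l =>
    if l < n then (if i < n then G i l else e l) else (if i < n then xy2 * φ i else g)
  let a'' : ℕ → ℝ := fun i => if i < n then a' i else ay'
  let v : ℕ → ℝ := fun i => if i < n then xy2 * c i else 1
  have hGrow : ∀ (i : ℕ) (h : ℕ → ℝ), ∑ l ∈ range (n + 1), G' i l * h l =
      ∑ l ∈ range n, (if i < n then G i l else e l) * h l + (if i < n then xy2 * φ i else g) * h n := by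
    intro i h
    have := sum_range_succ_ite (n := n) (fun l => (if i < n then G i l else e l) * h l)
      (fun l => (if i < n then xy2 * φ i else g) * h l)
    rw [← this]
    refine sum_congr rfl fun l _ => ?_
    by_cases hl : l < n <;> simp [G', hl]
  have hzero := eq_zero_of_subsolution (m := n + 1) (G := G') (a := a'') (v := v) ?_ ?_ ?_ ?_ ?_
  · have h1 : v n = 0 := hzero n (Nat.lt_succ_self n)
    simp only [v, lt_irrefl, if_false] at h1
    exact one_ne_zero h1
  · intro i l hi hl
    by_cases hi' : i < n <;> by_cases hl' : l < n
    · simp only [G', hi', hl', if_true]; exact hG i l hi' hl'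
    · simp only [G', hi', hl', if_true, if_false]; exact mul_nonneg hxy (hφ i hi')
    · simp only [G', hi', hl', if_true, if_false]; exact he l hl'
    · simp only [G', hi', hl', if_false]; exact hg
  · intro i hi
    by_cases hi' : i < n
    · simp only [a'', hi', if_true]; exact ha' i hi'
    · simp only [a'', hi', if_false]; exact hay'
  · intro i hi
    rw [hGrow]
    by_cases hi' : i < n
    · simp only [a'', hi', if_true, lt_irrefl, if_false]
      have : ∑ l ∈ range n, G i l * (if l < n then a' l else ay') = ∑ l ∈ range n, G i l * a' l :=
        sum_congr rfl fun l hl => by rw [if_pos (mem_range.mp hl)]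
      rw [this]; linarith [hrow i hi']
    · have hin : i = n := by omega
      subst hin
      simp only [a'', lt_irrefl, if_false]
      have : ∑ l ∈ range i, e l * (if l < i then a' l else ay') = ∑ l ∈ range i, e l * a' l :=
        sum_congr rfl fun l hl => by rw [if_pos (mem_range.mp hl)]
      rw [this]; linarith [hrowy]
  · intro i hi
    by_cases hi' : i < n
    · simp only [v, hi', if_true]; exact mul_nonneg hxy (hc0 i hi')
    · simp only [v, hi', if_false]; exact zero_le_one
  · intro i hi
    rw [hGrow]
    by_cases hi' : i < n
    · simp only [v, hi', if_true, lt_irrefl, if_false, mul_one]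
      have : ∑ l ∈ range n, G i l * (if l < n then xy2 * c l else 1) = xy2 * ∑ l ∈ range n, G i l * c l := by
        rw [mul_sum]; exact sum_congr rfl fun l hl => by rw [if_pos (mem_range.mp hl)]; ring
      rw [this]
      have h2 : xy2 * c i = xy2 * ∑ l ∈ range n, G i l * c l + xy2 * φ i := by rw [hc i hi']; ring
      rw [h2]
    · have hin : i = n := by omega
      subst hin
      simp only [v, lt_irrefl, if_false, mul_one]
      have : ∑ l ∈ range i, e l * (if l < i then xy2 * c l else 1) = xy2 * ∑ l ∈ range i, e l * c l := by
        rw [mul_sum]; exact sum_congr rfl fun l hl => by rw [if_pos (mem_range.mp hl)]; ring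
      rw [this]; linarith

/-! ## §2 Rank-one update of a row functional under bordering -/

/-- **RANK-ONE UPDATE.**  In the setting of `bordered_response`, any row functional `(f, f_y)` evaluated on the bordered response splits as
`Σ_l f_l u'_l + f_y u'_y = Σ_l f_l u_l + (xy2·Σ_l f_l c_l + f_y)·(w_y + Σ_l e_l u_l)∕D`.  THE CASE THE INDUCTION NEEDS (README §4): observer `z < y`,
`f = e_z` (`2x_lσ_l(z)`), `f_y = 2x_yσ_y(z)`, source `w = φ^z` (`S(z,k_l)∕z`), `w_y = φ_y(z) = S(z,y)∕z`; then `Σ f c = Ψ_yz` (the new age's reads amplified by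
the old system, charged on `z`'s row), `Σ e u = Ψ_zy`, and the identity reads **`Ψ'_zz = Ψ_zz + (2x_y∕D_y)(σ_y(z) + Ψ_yz)(φ_y(z) + Ψ_zy)`** (verified to
`2e-15` on random configurations, `g69/numerics/jobB`). [folklore] -/
theorem functional_bordered {u' : ℕ → ℝ} {uy' : ℝ}
    (hD0 : D ≠ 0) (huy' : uy' = (wy + ∑ l ∈ range n, e l * u l) / D)
    (hu' : ∀ i, i < n → u' i = u i + xy2 * uy' * c i) :
    ∑ l ∈ range n, f l * u' l + fy * uy' =
      ∑ l ∈ range n, f l * u l + (xy2 * ∑ l ∈ range n, f l * c l + fy) * (wy + ∑ l ∈ range n, e l * u l) / D := by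
  have hsplit : ∑ l ∈ range n, f l * u' l = ∑ l ∈ range n, f l * u l + xy2 * uy' * ∑ l ∈ range n, f l * c l := by
    rw [mul_sum, ← sum_add_distrib]
    exact sum_congr rfl fun l hl => by rw [hu' l (mem_range.mp hl)]; ring
  rw [hsplit, huy']
  field_simp
  ring

/-! ## §3 The covariance bound: near-proportional observers make the cross Gram determinant small -/

/-- Shifted covariance of weighted double sums, expanded. [folklore] -/
theorem wsum_shift (W : ℕ → ℕ → ℝ) (α β : ℕ → ℝ) (α₀ β₀ : ℝ) :
    ∑ i ∈ range n, ∑ l ∈ range n, W i l * ((α i - α₀) * (β l - β₀)) =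
      ∑ i ∈ range n, ∑ l ∈ range n, W i l * (α i * β l) - β₀ * ∑ i ∈ range n, ∑ l ∈ range n, W i l * α i
        - α₀ * ∑ i ∈ range n, ∑ l ∈ range n, W i l * β l + α₀ * β₀ * ∑ i ∈ range n, ∑ l ∈ range n, W i l := by
  have h : ∀ i l, W i l * ((α i - α₀) * (β l - β₀)) =
      W i l * (α i * β l) - β₀ * (W i l * α i) - α₀ * (W i l * β l) + α₀ * β₀ * W i l := fun i l => by ring
  simp only [h, sum_add_distrib, sum_sub_distrib, ← mul_sum]

/-- **THE COVARIANCE BOUND (Chebyshev form).**  Weights `W_{il} ≥ 0` (`i,l < n`), a row sequence `α_i ∈ [α₀, α₀ + Δα]` and a column sequence `β_l ∈ [β₀,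
β₀ + Δβ]`.  Then `(ΣΣ W)(ΣΣ Wα_iβ_l) ≤ (ΣΣ Wα_i)(ΣΣ Wβ_l) + Δα·Δβ·(ΣΣ W)²`.  THE USE (README §5): `W_{il} = (e_y)_i R_{il} (φ^y)_l ≥ 0` (the old
resolvent sandwiched between the new age's row and column), `α_i = σ_i(z)∕σ_i(y)`, `β_l = φ^z_l∕φ^y_l` the OBSERVER RATIOS of a scale `z < y`; then
`ΣΣW = Ψ_yy`, `ΣΣWα = Ψ_yz`, `ΣΣWβ = Ψ_zy`, `ΣΣWαβ = Ψ_zz`, and the bound says `Ψ_yyΨ_zz − Ψ_yzΨ_zy ≤ ΔαΔβ·Ψ_yy²`: for close observers the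
spreads are tiny (`y = 257`, `z = 256`: `Δα ≈ 6e-4`, `Δβ ≈ 1.3e-3`), so the cross products of the step inequality (◆) behave as if the resolvent were rank one
(measured `det∕(Ψ_yyΨ_zz) ≤ 5e-6` at every maximiser of `jobB`). [folklore] -/
theorem covariance_bound (W : ℕ → ℕ → ℝ) (α β : ℕ → ℝ) (α₀ β₀ Δα Δβ : ℝ)
    (hW : ∀ i l, i < n → l < n → 0 ≤ W i l)
    (hα : ∀ i, i < n → α₀ ≤ α i ∧ α i ≤ α₀ + Δα) (hβ : ∀ l, l < n → β₀ ≤ β l ∧ β l ≤ β₀ + Δβ) :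
    (∑ i ∈ range n, ∑ l ∈ range n, W i l) * (∑ i ∈ range n, ∑ l ∈ range n, W i l * (α i * β l)) ≤
      (∑ i ∈ range n, ∑ l ∈ range n, W i l * α i) * (∑ i ∈ range n, ∑ l ∈ range n, W i l * β l)
        + Δα * Δβ * (∑ i ∈ range n, ∑ l ∈ range n, W i l) ^ 2 := by
  set Sw := ∑ i ∈ range n, ∑ l ∈ range n, W i l with hSw
  set Sa := ∑ i ∈ range n, ∑ l ∈ range n, W i l * α i with hSa
  set Sb := ∑ i ∈ range n, ∑ l ∈ range n, W i l * β l with hSb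
  set Sab := ∑ i ∈ range n, ∑ l ∈ range n, W i l * (α i * β l) with hSab
  set X := ∑ i ∈ range n, ∑ l ∈ range n, W i l * ((α i - α₀) * (β l - β₀)) with hX
  have hXid : X = Sab - β₀ * Sa - α₀ * Sb + α₀ * β₀ * Sw := wsum_shift W α β α₀ β₀
  have hSw0 : 0 ≤ Sw := sum_nonneg fun i hi => sum_nonneg fun l hl => hW i l (mem_range.mp hi) (mem_range.mp hl)
  -- `X ≤ Δα Δβ Sw` termwise
  have hXle : X ≤ Δα * Δβ * Sw := by
    rw [hX, hSw, mul_sum]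
    refine sum_le_sum fun i hi => ?_
    rw [mul_sum]
    refine sum_le_sum fun l hl => ?_
    have hi' := mem_range.mp hi; have hl' := mem_range.mp hl
    have h1 : 0 ≤ α i - α₀ := by linarith [(hα i hi').1]
    have h2 : α i - α₀ ≤ Δα := by linarith [(hα i hi').2]
    have h3 : 0 ≤ β l - β₀ := by linarith [(hβ l hl').1]
    have h4 : β l - β₀ ≤ Δβ := by linarith [(hβ l hl').2]
    have h5 : (α i - α₀) * (β l - β₀) ≤ Δα * Δβ := mul_le_mul h2 h4 h3 (h1.trans h2)
    calc W i l * ((α i - α₀) * (β l - β₀)) ≤ W i l * (Δα * Δβ) := mul_le_mul_of_nonneg_left h5 (hW i l hi' hl')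
      _ = Δα * Δβ * W i l := by ring
  -- the shifted first moments are non-negative
  have hYa : 0 ≤ Sa - α₀ * Sw := by
    have : Sa - α₀ * Sw = ∑ i ∈ range n, ∑ l ∈ range n, W i l * (α i - α₀) := by
      rw [hSa, hSw, mul_sum, ← sum_sub_distrib]
      refine sum_congr rfl fun i _ => ?_
      rw [mul_sum, ← sum_sub_distrib]
      exact sum_congr rfl fun l _ => by ring
    rw [this]
    exact sum_nonneg fun i hi => sum_nonneg fun l hl =>
      mul_nonneg (hW i l (mem_range.mp hi) (mem_range.mp hl)) (by linarith [(hα i (mem_range.mp hi)).1])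
  have hYb : 0 ≤ Sb - β₀ * Sw := by
    have : Sb - β₀ * Sw = ∑ i ∈ range n, ∑ l ∈ range n, W i l * (β l - β₀) := by
      rw [hSb, hSw, mul_sum, ← sum_sub_distrib]
      refine sum_congr rfl fun i _ => ?_
      rw [mul_sum, ← sum_sub_distrib]
      exact sum_congr rfl fun l _ => by ring
    rw [this]
    exact sum_nonneg fun i hi => sum_nonneg fun l hl =>
      mul_nonneg (hW i l (mem_range.mp hi) (mem_range.mp hl)) (by linarith [(hβ l (mem_range.mp hl)).1])
  -- `Sw·Sab − Sa·Sb = Sw·X − (Sa − α₀Sw)(Sb − β₀Sw)`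
  have hT : Sw * Sab - Sa * Sb = Sw * X - (Sa - α₀ * Sw) * (Sb - β₀ * Sw) := by rw [hXid]; ring
  nlinarith [mul_nonneg hYa hYb, mul_le_mul_of_nonneg_left hXle hSw0]

/-! ## §4 Subsolution lower bounds: levels from row sums, and the structural lemma «window mass ≤ return amplification» -/

/-- **SUB-RESPONSES ARE BELOW RESPONSES.**  If `q_i ≤ w_i + Σ_l G_{il}q_l` for every row (a sub-response to the source `w`) and `u` is the exact response,
then `q ≤ u` (positive levels assumed; (E78a) `nonneg_of_response` applied to `u − q`). [folklore] -/
theorem subresponse_le_response (hG : ∀ i l, i < n → l < n → 0 ≤ G i l) (ha : ∀ i, i < n → 0 < a i)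
    (hlev : ∀ i, i < n → 1 + ∑ l ∈ range n, G i l * a l ≤ a i)
    (hq : ∀ i, i < n → q i ≤ w i + ∑ l ∈ range n, G i l * q l)
    (hu : ∀ i, i < n → u i = w i + ∑ l ∈ range n, G i l * u l) : ∀ i, i < n → q i ≤ u i := by
  have h := nonneg_of_response (u := fun i => u i - q i) (w := fun i => w i + ∑ l ∈ range n, G i l * q l - q i) hG ha hlev
    (fun i hi => by linarith [hq i hi]) ?_
  · intro i hi; linarith [h i hi]
  · intro i hi
    have hsplit : ∑ l ∈ range n, G i l * (u l - q l) = ∑ l ∈ range n, G i l * u l - ∑ l ∈ range n, G i l * q l := by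
      rw [← sum_sub_distrib]; exact sum_congr rfl fun _ _ => by ring
    simp only [hsplit]; linarith [hu i hi]

/-- **LEVELS FROM ROW SUMS.**  If every row sum is at least `γ` (`Σ_l G_{il} ≥ γ`, `γ < 1`) then the exact levels satisfy `a_i ≥ 1∕(1−γ)`: the constant
vector `1∕(1−γ)` is a sub-response to the source `1`. [folklore] -/
theorem level_ge_of_rowsum {γ : ℝ} (hG : ∀ i l, i < n → l < n → 0 ≤ G i l) (ha0 : ∀ i, i < n → 0 < a i)
    (ha : ∀ i, i < n → a i = 1 + ∑ l ∈ range n, G i l * a l) (hγ1 : γ < 1)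
    (hrow : ∀ i, i < n → γ ≤ ∑ l ∈ range n, G i l) : ∀ i, i < n → 1 / (1 - γ) ≤ a i := by
  refine subresponse_le_response (q := fun _ => 1 / (1 - γ)) (w := fun _ => 1) hG ha0 (fun i hi => (ha i hi).symm.le) ?_ ha
  intro i hi
  have h1 : ∑ l ∈ range n, G i l * (fun _ => 1 / (1 - γ)) l = (∑ l ∈ range n, G i l) * (1 / (1 - γ)) := by
    rw [sum_mul]
  rw [h1]
  have hpos : 0 < 1 - γ := by linarith
  have h2 : γ * (1 / (1 - γ)) ≤ (∑ l ∈ range n, G i l) * (1 / (1 - γ)) :=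
    mul_le_mul_of_nonneg_right (hrow i hi) (by positivity)
  have h3 : (1 : ℝ) / (1 - γ) = 1 + γ * (1 / (1 - γ)) := by field_simp; ring
  linarith

/-- **THE STRUCTURAL LEMMA «WINDOW MASS ≤ RETURN AMPLIFICATION» (abstract form).**  Old system with `G ≥ 0`, exact levels `a > 0`, every row sum `≥ γ`
(`γ < 1`); the new age's row `e ≥ 0` and reads `φ_i ≥ φ₀ ≥ 0`; `c` the exact response to `φ`.  Then the return amplification dominates
**`Ψ = Σ_l e_l c_l ≥ φ₀·(Σ_l e_l)∕(1 − γ)`** (`c ≥ φ₀·a` by (E78a) `response_ge_mul_level`, `a ≥ 1∕(1−γ)` by `level_ge_of_rowsum`).  THE USE (README §5): at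
the new age `y`, `φ₀ = S(y,y+1)∕y`, `Σ_l e_l = 2Σ_l x_lσ_l(y) ≥ (2S(y+1,y)∕y)·Ω_y` and `γ ≥ (2S(y+1,y+1)∕y)·Ω_y` (every `S(k_l,k_i) ≥ S(y+1,y+1)` for ages
above `y`), so **`Ψ_yy ≥ λ₁Ω_y∕(1 − λ₂Ω_y)`**, `λ₁ = 2S(y,y+1)S(y+1,y)∕y² → 1.372`, `λ₂ = 2S(y+1,y+1)∕y → 1.657` — TIGHT at a single light elder just
above `y`, which is exactly the binding configuration of the step inequality (`jobB`∕`jobC`). [folklore] -/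
theorem return_amplification_ge {γ φ₀ : ℝ} (hG : ∀ i l, i < n → l < n → 0 ≤ G i l) (ha0 : ∀ i, i < n → 0 < a i)
    (ha : ∀ i, i < n → a i = 1 + ∑ l ∈ range n, G i l * a l) (hγ1 : γ < 1)
    (hrow : ∀ i, i < n → γ ≤ ∑ l ∈ range n, G i l) (he : ∀ l, l < n → 0 ≤ e l) (hφ0 : 0 ≤ φ₀)
    (hφ : ∀ i, i < n → φ₀ ≤ φ i) (hc : ∀ i, i < n → c i = φ i + ∑ l ∈ range n, G i l * c l) :
    φ₀ * (∑ l ∈ range n, e l) / (1 - γ) ≤ ∑ l ∈ range n, e l * c l := by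
  have hca : ∀ i, i < n → φ₀ * a i ≤ c i := response_ge_mul_level hG ha0 ha hφ hc
  have hal : ∀ i, i < n → 1 / (1 - γ) ≤ a i := level_ge_of_rowsum hG ha0 ha hγ1 hrow
  have hpos : 0 < 1 - γ := by linarith
  calc φ₀ * (∑ l ∈ range n, e l) / (1 - γ) = ∑ l ∈ range n, e l * (φ₀ * (1 / (1 - γ))) := by
        rw [mul_sum, sum_div, ]; exact sum_congr rfl fun l _ => by field_simp
    _ ≤ ∑ l ∈ range n, e l * c l := sum_le_sum fun l hl => by
        have hl' := mem_range.mp hl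
        refine mul_le_mul_of_nonneg_left ?_ (he l hl')
        calc φ₀ * (1 / (1 - γ)) ≤ φ₀ * a l := mul_le_mul_of_nonneg_left (hal l hl') hφ0
          _ ≤ c l := hca l hl'

/-- The lattice form of the structural lemma: from `Ψ ≥ φ₀·E∕(1−γ)` with `E ≥ λ_e·Ω` and `γ ≥ λ₂·Ω` (`φ₀, λ_e, Ω ≥ 0`) conclude
`Ψ ≥ φ₀λ_e·Ω∕(1 − λ₂Ω)`. [folklore] -/
theorem return_amplification_ge_window {Ψ E γ φ₀ Ω lamE lam2 : ℝ} (hΨ : φ₀ * E / (1 - γ) ≤ Ψ) (hE : lamE * Ω ≤ E) (hγ : lam2 * Ω ≤ γ) (hγ1 : γ < 1)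
    (hφ0 : 0 ≤ φ₀) (hlamE : 0 ≤ lamE) (hΩ : 0 ≤ Ω) :
    φ₀ * lamE * Ω / (1 - lam2 * Ω) ≤ Ψ := by
  have h1 : 0 < 1 - γ := by linarith
  have h2 : 0 < 1 - lam2 * Ω := by linarith
  refine le_trans ?_ hΨ
  rw [div_le_div_iff₀ h2 h1]
  have h3 : φ₀ * lamE * Ω ≤ φ₀ * E := by rw [mul_assoc]; exact mul_le_mul_of_nonneg_left hE hφ0
  have hE0 : 0 ≤ E := le_trans (mul_nonneg hlamE hΩ) hE
  have h4 : 0 ≤ φ₀ * E := mul_nonneg hφ0 hE0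
  nlinarith [mul_le_mul h3 (by linarith : 1 - γ ≤ 1 - lam2 * Ω) h1.le h4]


/-! ## §5 The structural lemma on the lattice: `Ψ_yy ≥ λ₁Ω_y∕(1 − λ₂Ω_y)` with explicit read-window constants -/

open Summit.QuantumFields.BalabanUV.Beta.EriceRemainderEnclosureHistoryAutonomyComparisonAgeCompositionStaticChainWindowMass in
/-- The read window `S_{k,j} = Σ_{l<j} √(k∕(k+l+1))` is non-decreasing in the window length `j`. [folklore] -/
theorem readWindow_mono_right (k : ℝ) {j j' : ℕ} (hjj : j ≤ j') :
    ∑ l ∈ range j, Real.sqrt (k / (k + l + 1)) ≤ ∑ l ∈ range j', Real.sqrt (k / (k + l + 1)) :=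
  sum_le_sum_of_subset_of_nonneg (Finset.range_subset_range.mpr hjj) fun _ _ _ => Real.sqrt_nonneg _

open Summit.QuantumFields.BalabanUV.Beta.EriceRemainderEnclosureHistoryAutonomyComparisonAgeCompositionStaticChainWindowMass in
/-- **THE STRUCTURAL LEMMA ON THE LATTICE.**  Ages `k_l ≥ y + 1` (`l < n`, integers) above a scale `y ≥ 1`, loads `x_l ≥ 0`; the level-coupled array
`G_{il} = 2x_l S_{k_l,k_i}∕k_l`; exact levels `a > 0` and the exact response `c` to the reads `φ_i = S_{y,k_i}∕y` of the scale `y`; window mass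
`Ω_y := Σ_l x_l·y∕k_l` with `λ₂Ω_y < 1`.  Then the return amplification `Ψ_yy = Σ_l (2x_l S_{k_l,y}∕k_l)·c_l` obeys
**`Ψ_yy ≥ λ₁·Ω_y∕(1 − λ₂·Ω_y)`**, `λ₁ = 2(S_{y,y+1}∕y)(S_{y+1,y}∕y)` (`→ 8(√2−1)² = 1.372`), `λ₂ = 2S_{y+1,y+1}∕y` (`→ 4(√2−1) = 1.657`): every row sum is
`≥ λ₂Ω_y` (`S_{k_l,k_i} ≥ S_{y+1,y+1}`, both monotonicities of the read window), every `φ_i ≥ S_{y,y+1}∕y`, and `Σ_l 2x_lS_{k_l,y}∕k_l ≥ (2S_{y+1,y}∕y)Ω_y`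
((E74a) `readWindow_mono_left`); then `return_amplification_ge` and `return_amplification_ge_window`.  Numerically TIGHT (ratio → 1) at one light elder at
age `y+1` (`g69/numerics/jobC`), the binding configuration of the whole induction. [folklore] -/
theorem return_amplification_ge_lattice {y : ℕ} {k : ℕ → ℕ} {x : ℕ → ℝ} (hy : 1 ≤ y) (hk : ∀ l, l < n → y + 1 ≤ k l)
    (hx : ∀ l, l < n → 0 ≤ x l)
    (ha0 : ∀ i, i < n → 0 < a i)
    (ha : ∀ i, i < n → a i = 1 + ∑ l ∈ range n,
      (2 * x l * (∑ m ∈ range (k i), Real.sqrt ((k l : ℝ) / ((k l : ℝ) + m + 1))) / k l) * a l)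
    (hc : ∀ i, i < n → c i = (∑ m ∈ range (k i), Real.sqrt ((y : ℝ) / ((y : ℝ) + m + 1))) / y + ∑ l ∈ range n,
      (2 * x l * (∑ m ∈ range (k i), Real.sqrt ((k l : ℝ) / ((k l : ℝ) + m + 1))) / k l) * c l)
    (hΩ : 2 * (∑ m ∈ range (y + 1), Real.sqrt (((y:ℝ) + 1) / (((y:ℝ) + 1) + m + 1))) / y * ∑ l ∈ range n, x l * y / k l < 1) :
    ((∑ m ∈ range (y + 1), Real.sqrt ((y : ℝ) / ((y : ℝ) + m + 1))) / y) *
        (2 * (∑ m ∈ range y, Real.sqrt (((y:ℝ) + 1) / (((y:ℝ) + 1) + m + 1))) / y) * (∑ l ∈ range n, x l * y / k l) /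
        (1 - (2 * (∑ m ∈ range (y + 1), Real.sqrt (((y:ℝ) + 1) / (((y:ℝ) + 1) + m + 1))) / y) * ∑ l ∈ range n, x l * y / k l)
      ≤ ∑ l ∈ range n, (2 * x l * (∑ m ∈ range y, Real.sqrt ((k l : ℝ) / ((k l : ℝ) + m + 1))) / k l) * c l := by
  have hy0 : (0 : ℝ) < y := by exact_mod_cast hy
  have hkpos : ∀ l, l < n → (0 : ℝ) < k l := fun l hl => by
    have := hk l hl; exact_mod_cast (show 0 < k l by omega)
  have hk1 : ∀ l, l < n → ((y : ℝ) + 1) ≤ (k l : ℝ) := fun l hl => by exact_mod_cast hk l hl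
  set S11 := ∑ m ∈ range (y + 1), Real.sqrt (((y:ℝ) + 1) / (((y:ℝ) + 1) + m + 1)) with hS11
  set S10 := ∑ m ∈ range y, Real.sqrt (((y:ℝ) + 1) / (((y:ℝ) + 1) + m + 1)) with hS10
  set S01 := ∑ m ∈ range (y + 1), Real.sqrt ((y : ℝ) / ((y : ℝ) + m + 1)) with hS01
  set Ω := ∑ l ∈ range n, x l * y / k l with hΩdef
  have hΩ0 : 0 ≤ Ω := sum_nonneg fun l hl => by
    have := hx l (mem_range.mp hl); have := hkpos l (mem_range.mp hl); positivity
  have hS01_0 : 0 ≤ S01 / y := div_nonneg (sum_nonneg fun _ _ => Real.sqrt_nonneg _) hy0.le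
  have hS10_0 : 0 ≤ 2 * S10 / y := by have : 0 ≤ S10 := sum_nonneg fun _ _ => Real.sqrt_nonneg _; positivity
  have hG : ∀ i l, i < n → l < n →
      0 ≤ 2 * x l * (∑ m ∈ range (k i), Real.sqrt ((k l : ℝ) / ((k l : ℝ) + m + 1))) / k l := fun i l hi hl => by
    have := hx l hl; have := hkpos l hl
    have : 0 ≤ ∑ m ∈ range (k i), Real.sqrt ((k l : ℝ) / ((k l : ℝ) + m + 1)) := sum_nonneg fun _ _ => Real.sqrt_nonneg _
    positivity
  have hrow : ∀ i, i < n → 2 * S11 / y * Ω ≤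
      ∑ l ∈ range n, 2 * x l * (∑ m ∈ range (k i), Real.sqrt ((k l : ℝ) / ((k l : ℝ) + m + 1))) / k l := by
    intro i hi
    rw [hΩdef, mul_sum]
    refine sum_le_sum fun l hl => ?_
    have hl' := mem_range.mp hl
    have hSS : S11 ≤ ∑ m ∈ range (k i), Real.sqrt ((k l : ℝ) / ((k l : ℝ) + m + 1)) :=
      calc S11 ≤ ∑ m ∈ range (k i), Real.sqrt (((y:ℝ) + 1) / (((y:ℝ) + 1) + m + 1)) :=
            readWindow_mono_right _ (hk i hi)
        _ ≤ _ := readWindow_mono_left (by positivity) (hk1 l hl') (k i)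
    have hxl := hx l hl'; have hkl := hkpos l hl'
    rw [show 2 * S11 / y * (x l * y / k l) = 2 * x l * S11 / k l by field_simp]
    exact div_le_div_of_nonneg_right (by nlinarith) hkl.le
  have hφ : ∀ i, i < n → S01 / y ≤ (∑ m ∈ range (k i), Real.sqrt ((y : ℝ) / ((y : ℝ) + m + 1))) / y := fun i hi =>
    div_le_div_of_nonneg_right (readWindow_mono_right _ (hk i hi)) hy0.le
  have hE : 2 * S10 / y * Ω ≤ ∑ l ∈ range n, 2 * x l * (∑ m ∈ range y, Real.sqrt ((k l : ℝ) / ((k l : ℝ) + m + 1))) / k l := by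
    rw [hΩdef, mul_sum]
    refine sum_le_sum fun l hl => ?_
    have hl' := mem_range.mp hl
    have hSS : S10 ≤ ∑ m ∈ range y, Real.sqrt ((k l : ℝ) / ((k l : ℝ) + m + 1)) :=
      readWindow_mono_left (by positivity) (hk1 l hl') y
    have hxl := hx l hl'; have hkl := hkpos l hl'
    rw [show 2 * S10 / y * (x l * y / k l) = 2 * x l * S10 / k l by field_simp]
    exact div_le_div_of_nonneg_right (by nlinarith) hkl.le
  have he0 : ∀ l, l < n → 0 ≤ 2 * x l * (∑ m ∈ range y, Real.sqrt ((k l : ℝ) / ((k l : ℝ) + m + 1))) / k l := fun l hl => by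
    have := hx l hl; have := hkpos l hl
    have : 0 ≤ ∑ m ∈ range y, Real.sqrt ((k l : ℝ) / ((k l : ℝ) + m + 1)) := sum_nonneg fun _ _ => Real.sqrt_nonneg _
    positivity
  have hγ1 : 2 * S11 / y * Ω < 1 := hΩ
  have hmain := return_amplification_ge (G := fun i l => 2 * x l * (∑ m ∈ range (k i), Real.sqrt ((k l : ℝ) / ((k l : ℝ) + m + 1))) / k l)
    (e := fun l => 2 * x l * (∑ m ∈ range y, Real.sqrt ((k l : ℝ) / ((k l : ℝ) + m + 1))) / k l)
    (φ := fun i => (∑ m ∈ range (k i), Real.sqrt ((y : ℝ) / ((y : ℝ) + m + 1))) / y)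
    hG ha0 ha hγ1 hrow he0 hS01_0 hφ hc
  have := return_amplification_ge_window (lam2 := 2 * S11 / y) hmain hE le_rfl hγ1 hS01_0 hS10_0 hΩ0
  simpa [mul_assoc] using this

end Summit.QuantumFields.BalabanUV.Beta.EriceRemainderEnclosureHistoryAutonomyComparisonAgeCompositionStaticChainResolvent

end
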